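import Mathlib
import HarnessLib
import Summits.HubbardSuperconductivity.HubbardSuperconductivity.Theorems.KLProgrammeKLRegimeEngineTowerRemeasureNarrowWideTowerWtAll
import Summits.HubbardSuperconductivity.HubbardSuperconductivity.Theorems.KLProgrammeKLRegimeEngineNormsJumpLastLegCountUniform

/-!
# Route `KLProgramme` — crux K3 ENGINE (stmt-HubbardSuperconductivity-20437 `KLRegimeEngineV17F2`), stub (b) v2, THE LEVELS PACKAGE (ℓ), instantiation (I2):
# THE WEIGHTED SPLIT / NARROW–WIDE `_flow_all` ROWS WITH m-UNIFORM CONSTANTS (located item «(I2)-CONST-UNIFORM», weighted track, Files E–G of «(I2)-WT-WINDOW»;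
# cell gate-hubbard-kl, seat p4 g17)

Same proofs as `…RemeasureSplitWtAll` / `…RemeasureNarrowWideSplitWtAll` / `…RemeasureNarrowWideTowerWtAll` (p4 g17) with the degree `m` moved after the constants and
thresholds, the jump constant as `C₀^{m+1}` and the on-class one-determined-leg constant as `(D₂ + 1)(m + 2)³` (on `card_relCount_prescribed_lastLeg_klAniso_le_window_uniform`):

* **`klWtPinnedSumAt_jump_le_split_klEng_flow_all_uniform (R) (c″)`** — `∃ C₀ > 0, ∀ m, …: ≤ C₀^{m+1}·(A₁N + A₂N_B)`;
* **`klWtPinnedSumAt_jump_le_narrowWideSplit_klEng_flow_all_uniform (R) (c″)`** — `… (R.WF2 → ∃ c₃ U₀ Λ r₀ v₀, ∀ m, 3 ≤ m → …)`;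
* **`klWtPinnedSumAt_klTowerIncr_narrowWideSplit_le_klEng_flow_all_uniform (R) (c″)`** — the tower instance against `klTowerBornWtAt/klTowerBornWtFull`.
Compositions of landed theorems; nothing about the model is asserted beyond them; nothing asserts (ℓ), any stub, K3 or superconductivity.
References: BGM 2006 §2.8 (2.82)–(2.84), (2.88)–(2.90), App. A3 [cite: BenfattoGiulianiMastropietro2006].
-/

noncomputable section

namespace Summit.HubbardSuperconductivity.HubbardSuperconductivity.Theorems.EngineV8

set_option linter.dupNamespace false -- summit = problem name (single-conjunct summit), D-0017

open Classical
open Real Finset Literature.MathematicalPhysics.QuantumLattice Literature.Probability.LatticeModels GrassmannAlgebra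
open Literature.Probability.LatticeModels.BattleFederbush
open Literature.MathematicalPhysics.QuantumLattice.FermiRG
open Summit.HubbardSuperconductivity.HubbardSuperconductivity.Theorems.KLRegimeSplit
open Summit.HubbardSuperconductivity.HubbardSuperconductivity.Theorems.KLProgrammeLegKernels
open Summit.HubbardSuperconductivity.HubbardSuperconductivity.Theorems.DispersionFlow
open Summit.HubbardSuperconductivity.HubbardSuperconductivity.Theorems.KLRegimeWick
open Summit.HubbardSuperconductivity.HubbardSuperconductivity.Theorems.TorusFourierL2
open Summit.HubbardSuperconductivity.HubbardSuperconductivity.Theorems.PerturbedFermiCurve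

/-- **THE WEIGHTED SPLIT JUMP AT THE FLOW FRAME, NO WINDOW — m-UNIFORM** (twin of `klWtPinnedSumAt_jump_le_split_klEng_flow_all`; `C₀ = 3CJ/2`).
[cite: BenfattoGiulianiMastropietro2006, §2.8 (2.82)-(2.84), (2.88)-(2.90), App. A3] -/
theorem klWtPinnedSumAt_jump_le_split_klEng_flow_all_uniform (R : RenConsts) (c'' : ℝ) (hc'' : 0 ≤ c'') :
    ∃ C₀ : ℝ, 0 < C₀ ∧ ∀ m : ℕ,
      ∀ (G : GeoConsts) (P : SplitConsts) (Q : EngConsts) (cc : ℝ), R.WF2 → 0 < cc → cc ≤ klEngC₃6 P R →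
      ∀ μ ∈ klWindowC, ∀ U : ℝ, 0 < U → U ≤ min (klEngU₀3 P R cc) (1 / (R.Gfr 3 + 1)) → c'' * U ≤ 1 →
      ∀ β : ℝ, klBetaMin ≤ β → β ≤ Real.exp (cc / U ^ 2) →
      ∀ (L M : ℕ) [NeZero L] [NeZero M], klEngL₃ β U ≤ L → klEngM₃ β U L ≤ M →
      ∀ n : ℕ, 1 ≤ n → n ≤ nScales β + 1 → IsKLRegime U cc (-(n : ℤ)) → HistP klPredsV17F2 L M G P Q R β U μ 0 n →
        (∀ m', 1 ≤ m' → m' < n → FlowPieceOscAt L M c'' β U μ m') →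
        ∀ k J' : ℕ, k + 1 ≤ J' → J' ≤ n →
        ∀ T : HubbardGrassmann L M,
          (∀ (m' : ℕ) (X : Fin m' → HubbardFieldIdx L M), ∑ i, signedMomentum L (X i).2 (X i).1.1.2 ≠ 0 → kernel ℂ T m' X = 0) →
        ∀ j : ℕ, J' ≤ j → ∀ (B : Finset (Fin (m + 1) → SectorLeg (sectorCount k))) (q : Fin (m + 1))
          (w : SpaceTimeIdx L M × SectorLeg (sectorCount J')) (A₁ A₂ N NB : ℝ), 0 ≤ A₁ → 0 ≤ A₂ → 0 ≤ N → 0 ≤ NB →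
          (∀ (ℓ'' : SectorLeg (sectorCount J')) (σ' : Fin (m + 1) → SectorLeg (sectorCount k)), σ' ∉ B →
            (27 : ℝ) * ((((bgmSectorSet L M (klAnisoFamily L M β μ (klFlowFrameU L M β U μ n) klE0 J') (m + 1)).filter fun σ'' =>
              (∀ e ∈ ({q} : Finset (Fin (m + 1))), σ'' e = (fun _ : Fin (m + 1) => ℓ'') e) ∧ ∀ i,
              (∃ q' : FreqMomentum L M, klAnisoFamily L M β μ (klFlowFrameU L M β U μ n) klE0 J' (σ'' i).1.1 q' ≠ 0 ∧
                bgmFatMultiplier L M klE0 β (nambuXiCT L μ (klFlowFrameU L M β U μ n)) k (σ' i).1.1 q' ≠ 0) ∧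
              (σ' i).1.2 = (σ'' i).1.2 ∧ (σ' i).2 = (σ'' i).2).card : ℝ)) ≤ A₁) →
          (∀ (ℓ'' : SectorLeg (sectorCount J')) (σ' : Fin (m + 1) → SectorLeg (sectorCount k)), σ' ∈ B →
            (27 : ℝ) * ((((bgmSectorSet L M (klAnisoFamily L M β μ (klFlowFrameU L M β U μ n) klE0 J') (m + 1)).filter fun σ'' =>
              (∀ e ∈ ({q} : Finset (Fin (m + 1))), σ'' e = (fun _ : Fin (m + 1) => ℓ'') e) ∧ ∀ i,
              (∃ q' : FreqMomentum L M, klAnisoFamily L M β μ (klFlowFrameU L M β U μ n) klE0 J' (σ'' i).1.1 q' ≠ 0 ∧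
                bgmFatMultiplier L M klE0 β (nambuXiCT L μ (klFlowFrameU L M β U μ n)) k (σ' i).1.1 q' ≠ 0) ∧
              (σ' i).1.2 = (σ'' i).1.2 ∧ (σ' i).2 = (σ'' i).2).card : ℝ)) ≤ A₂) →
          (∀ w' : SpaceTimeIdx L M × SectorLeg (sectorCount k),
            klWtPinnedSumAt L M β μ (klFlowFrameU L M β U μ n) k j (m + 1) T q w' ≤ N) →
          (∀ (ℓ' : SectorLeg (sectorCount k)) (y' : SpaceTimeIdx L M),
            imagTimeWeight β M ^ m * ∑ σ' ∈ B.filter (fun σ' : Fin (m + 1) → SectorLeg (sectorCount k) => σ' q = ℓ'),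
              ∑ x' ∈ univ.filter (fun x' : Fin (m + 1) → SpaceTimeIdx L M => x' q = y'),
                klScaleWt L M β j ((univ.image x').image (fun x : SpaceTimeIdx L M => (((((2 * (x.1 : ℕ) : ℕ)) : ZMod (2 * (2 * M)))), x.2))) *
                  ‖sectorisedKernel L M β (klAnisoFamily L M β μ (klFlowFrameU L M β U μ n) klE0 k) T (m + 1) σ' x'‖ ≤ NB) →
          klWtPinnedSumAt L M β μ (klFlowFrameU L M β U μ n) J' j (m + 1) T q w ≤ C₀ ^ (m + 1) * (A₁ * N + A₂ * NB) := by
  obtain ⟨CJ, hCJ, hov⟩ := overlapWt_jump_sums_klEng_flow_all R c'' hc''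
  refine ⟨3 * CJ / 2, by positivity, ?_⟩
  intro m G P Q cc hR2 hcc hcc6 μ hμ U hU hUle hcU β hβmin hβc L M _ _ hL3 hM3 n hn1 hnN hkl hhist hosc k J' hJ hJn T hT j hjJ B q w A₁ A₂ N NB
    hA₁ hA₂ hN0 hNB0 hRoff hRon hN hNB
  have hβ : 0 < β := KLRegimeSplit.pos_of_klBetaMin_le hβmin
  set K : TrigPolyC4v := klFlowFrameU L M β U μ n with hK
  obtain ⟨_, hcolJ, hrowJ⟩ := hov G P Q cc hR2 hcc hcc6 μ hμ U hU hUle hcU β hβmin hβc L M hL3 hM3 n hn1 hnN hkl hhist hosc k J' hJ hJn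
  have hc₁0 : (0 : ℝ) ≤ 3 * CJ * M / β := by positivity
  have hcol₁ : ∀ (ω'' : Fin (sectorCount J')) (ω' : Fin (sectorCount k)) (σ c : Fin 2) (x' : SpaceTimeIdx L M),
      ∑ x'' : SpaceTimeIdx L M, ‖(sectorAnalysisMatrix L M β (klAnisoFamily L M β μ K klE0 J') *
        sectorSubMatrix L M β (bgmFatMultiplier L M klE0 β (nambuXiCT L μ K) k)) (x'', ((ω'', σ), c)) (x', ((ω', σ), c))‖ *
          klScaleWt L M β j
            {latticeLegPos (2 * (2 * M)) ((x'', ((ω'', σ), c)) : SpaceTimeIdx L M × SectorLeg (sectorCount J')),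
              latticeLegPos (2 * (2 * M)) ((x', ((ω', σ), c)) : SpaceTimeIdx L M × SectorLeg (sectorCount k))} ≤ 3 * CJ * M / β := by
    intro ω'' ω' σ c x'
    refine le_trans (sum_le_sum fun x'' _ => mul_le_mul_of_nonneg_left (klScaleWt_le_of_le β hjJ _) (norm_nonneg _)) ?_
    exact hcolJ ω'' ω' σ c x'
  have hrow₁ : ∀ (ω'' : Fin (sectorCount J')) (ω' : Fin (sectorCount k)) (σ c : Fin 2) (x'' : SpaceTimeIdx L M),
      ∑ x' : SpaceTimeIdx L M, ‖(sectorAnalysisMatrix L M β (klAnisoFamily L M β μ K klE0 J') *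
        sectorSubMatrix L M β (bgmFatMultiplier L M klE0 β (nambuXiCT L μ K) k)) (x'', ((ω'', σ), c)) (x', ((ω', σ), c))‖ *
          klScaleWt L M β j
            {latticeLegPos (2 * (2 * M)) ((x'', ((ω'', σ), c)) : SpaceTimeIdx L M × SectorLeg (sectorCount J')),
              latticeLegPos (2 * (2 * M)) ((x', ((ω', σ), c)) : SpaceTimeIdx L M × SectorLeg (sectorCount k))} ≤ 3 * CJ * M / β := by
    intro ω'' ω' σ c x''
    refine le_trans (sum_le_sum fun x' _ => mul_le_mul_of_nonneg_left (klScaleWt_le_of_le β hjJ _) (norm_nonneg _)) ?_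
    exact hrowJ ω'' ω' σ c x''
  have h := klWtPinnedSumAt_jump_le_split_of_consts hβ μ K hJ T hT j hc₁0 hc₁0 hcol₁ hrow₁ m B q w hA₁ hA₂ hN0 hNB0 hRoff hRon hN hNB
  have hMne : (M : ℝ) ≠ 0 := by exact_mod_cast NeZero.ne M
  have hεc : imagTimeWeight β M * (3 * CJ * M / β) = 3 * CJ / 2 := by
    unfold imagTimeWeight; field_simp
  have hconst : (3 * CJ * M / β) ^ m * (3 * CJ * M / β) * imagTimeWeight β M ^ (m + 1) = (3 * CJ / 2) ^ (m + 1) := by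
    rw [← pow_succ, ← mul_pow, mul_comm (3 * CJ * M / β), hεc]
  calc klWtPinnedSumAt L M β μ K J' j (m + 1) T q w
      ≤ (3 * CJ * M / β) ^ m * (3 * CJ * M / β) * imagTimeWeight β M ^ (m + 1) * (A₁ * N + A₂ * NB) := h
    _ = (3 * CJ / 2) ^ (m + 1) * (A₁ * N + A₂ * NB) := by rw [hconst]

/-- **THE WEIGHTED NARROW / WIDE SPLIT JUMP AT THE FLOW FRAME, NO WINDOW — m-UNIFORM** (twin of `klWtPinnedSumAt_jump_le_narrowWideSplit_klEng_flow_all`).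
[cite: BenfattoGiulianiMastropietro2006, §2.8 (2.82)-(2.84), (2.88)-(2.90), App. A3] -/
theorem klWtPinnedSumAt_jump_le_narrowWideSplit_klEng_flow_all_uniform (R : RenConsts) (c'' : ℝ) (hc'' : 0 ≤ c'') :
    ∃ C₀ : ℝ, 0 < C₀ ∧ ∃ C : ℝ, 0 < C ∧ ∃ D₁ : ℝ, 0 < D₁ ∧ ∃ Cw : ℝ, 0 < Cw ∧
      ∃ c₂ cb K₁ K₂ c₀ c₂' : ℝ, 0 ≤ c₂ ∧ 0 < cb ∧ 2 + c₂ ≤ K₁ ∧ 0 < K₂ ∧ 0 < c₀ ∧ 0 < c₂' ∧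
      ∃ D₂ : ℝ, 0 < D₂ ∧ ∃ k₀ : ℕ,
      (R.WF2 → ∃ c₃ : ℝ, 0 < c₃ ∧ ∃ U₀ : ℝ, 0 < U₀ ∧ ∃ Λ : ℝ, 0 ≤ Λ ∧ ∃ r₀ : ℝ, 0 < r₀ ∧ ∃ v₀ : ℝ, 0 < v₀ ∧
      ∀ m : ℕ, 3 ≤ m →
      ∀ (G : GeoConsts) (P : SplitConsts) (Q : EngConsts) (cc : ℝ), 0 < cc → cc ≤ klEngC₃6 P R → cc ≤ c₃ →
      ∀ μ ∈ klWindowC, ∀ U : ℝ, 0 < U → U ≤ min (klEngU₀3 P R cc) (1 / (R.Gfr 3 + 1)) → U ≤ U₀ → c'' * U ≤ 1 →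
      ∀ β : ℝ, klBetaMin ≤ β → β ≤ Real.exp (cc / U ^ 2) →
      ∀ (L M : ℕ) [NeZero L] [NeZero M], klEngL₃ β U ≤ L → klEngM₃ β U L ≤ M →
      ∀ n : ℕ, 1 ≤ n → n ≤ nScales β + 1 → IsKLRegime U cc (-(n : ℤ)) → HistP klPredsV17F2 L M G P Q R β U μ 0 n →
        (∀ m', 1 ≤ m' → m' < n → FlowPieceOscAt L M c'' β U μ m') →
        ∀ k J' : ℕ, k₀ ≤ k → k + 1 ≤ J' → J' ≤ n →
      ∀ (Θ LΨ Bfib : ℝ), LΨ = (m + 1 : ℕ) + c₂ * (π / 2 + 5 * sectorWidth k) / (K₁ * Θ) → (2 : ℝ) ^ (-(J' : ℤ)) ≤ Θ →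
        cb * (2 : ℝ) ^ (-(J' : ℤ)) ≤ Θ → K₂ * LΨ * (cb * (2 : ℝ) ^ (-(J' : ℤ))) ≤ c₂' * Θ →
        max ((2 * ((2 * c₀ * K₂ * cb / π + 1) * LΨ)) ^ 2) (4 * cb ^ 2 * K₂ ^ 2 / 1 ^ 2 * LΨ ^ 2) ≤ Bfib →
      ((m : ℝ) + 1) * (Cw + C) * sectorWidth k < 2 * π →
      (((m : ℝ) + 1) * C + m * Λ * (⌊(Θ + 5 * sectorWidth k) / sectorWidth k⌋₊ : ℕ)) * sectorWidth k < v₀ →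
      ((m : ℝ) + 1) * C * sectorWidth k < π →
        ∀ T : HubbardGrassmann L M,
          (∀ (m' : ℕ) (X : Fin m' → HubbardFieldIdx L M), ∑ i, signedMomentum L (X i).2 (X i).1.1.2 ≠ 0 → kernel ℂ T m' X = 0) →
        ∀ j : ℕ, J' ≤ j → ∀ (q : Fin (m + 1)) (w : SpaceTimeIdx L M × SectorLeg (sectorCount J')) (N Nf : ℝ), 0 ≤ N → 0 ≤ Nf →
          (∀ w' : SpaceTimeIdx L M × SectorLeg (sectorCount k),
            klWtPinnedSumAt L M β μ (klFlowFrameU L M β U μ n) k j (m + 1) T q w' ≤ N) →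
          (∀ (σ' : Fin (m + 1) → SectorLeg (sectorCount k)) (y' : SpaceTimeIdx L M),
            imagTimeWeight β M ^ m *
              ∑ x' ∈ univ.filter (fun x' : Fin (m + 1) → SpaceTimeIdx L M => x' q = y'),
                klScaleWt L M β j ((univ.image x').image (fun x : SpaceTimeIdx L M => (((((2 * (x.1 : ℕ) : ℕ)) : ZMod (2 * (2 * M)))), x.2))) *
                  ‖sectorisedKernel L M β (klAnisoFamily L M β μ (klFlowFrameU L M β U μ n) klE0 k) T (m + 1) σ' x'‖ ≤ Nf) →
          klWtPinnedSumAt L M β μ (klFlowFrameU L M β U μ n) J' j (m + 1) T q w ≤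
            C₀ ^ (m + 1) * ((27 : ℝ) * (D₁ ^ (m + 1) + (5 : ℝ) ^ (m + 1) * ((m + 1 : ℕ) ^ 2 * (Bfib * 3 ^ (m - 2)))) * ((2 : ℝ) ^ (J' - k)) ^ (m - 2) * N +
              (D₂ + 1) * ((m : ℝ) + 2) ^ 3 * 27 ^ (m + 1) * ((2 : ℝ) ^ (J' - k)) ^ (m - 1) *
                ((2 * ((m : ℝ) + 1) + 1) ^ 2 * (2 * (8 * π * (((m : ℝ) + 1) * C + m * Λ * (⌊(Θ + 5 * sectorWidth k) / sectorWidth k⌋₊ : ℕ)) / r₀ + 2) *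
                  (8 * (2 * ((⌊(Θ + 5 * sectorWidth k) / sectorWidth k⌋₊ : ℕ) : ℝ) + 1)) ^ m)) * Nf)) := by
  obtain ⟨Cm, hCm, hsplit⟩ := klWtPinnedSumAt_jump_le_split_klEng_flow_all_uniform R c'' hc''
  obtain ⟨C, hC, D₁, hD₁, Cw, hCw, c₂, cb, K₁, K₂, c₀, c₂', h1, h2, h3, h4, h5, h6, k₀, hoffR⟩ :=
    card_relCount_prescribed_offOrWide_klAniso_le_window
  obtain ⟨D₂, hD₂, honR⟩ := card_relCount_prescribed_lastLeg_klAniso_le_window_uniform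
  refine ⟨Cm, hCm, C, hC, D₁, hD₁, Cw, hCw, c₂, cb, K₁, K₂, c₀, c₂', h1, h2, h3, h4, h5, h6, D₂, hD₂, k₀, fun hR2 => ?_⟩
  have hRj : ∀ j, 0 ≤ R.Gfr j := gfr_nonneg_of_wf2 hR2
  obtain ⟨c₃, hc₃, U₀, hU₀, hoff'⟩ := hoffR R hRj
  obtain ⟨c₃', hc₃', U₀', hU₀', hon'⟩ := honR R hRj
  obtain ⟨c₃'', hc₃'', U₀'', hU₀'', Λ, hΛ, r₀, hr₀, v₀, hv₀, hmult⟩ := card_onNarrow_pinned_le_window R hRj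
  refine ⟨min (min c₃ c₃') c₃'', lt_min (lt_min hc₃ hc₃') hc₃'', min (min U₀ U₀') U₀'', lt_min (lt_min hU₀ hU₀') hU₀'', Λ, hΛ, r₀, hr₀, v₀, hv₀, ?_⟩
  intro m hm G P Q cc hcc hcc6 hccm μ hμ U hU hUle hUm hcU β hβmin hβc L M _ _ hL3 hM3 n hn1 hnN hkl hhist hosc k J' hk₀ hJ hJn Θ LΨ Bfib hLΨ hΘt hΘδ hΘη hBfib
    hsmall hsmallv hπC T hT j hjJ q w N Nf hN0 hNf0 hN hNf
  have hD₂' : (0 : ℝ) ≤ (D₂ + 1) * ((m : ℝ) + 2) ^ 3 := by positivity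
  have hβ : 0 < β := KLRegimeSplit.pos_of_klBetaMin_le hβmin
  have hfr : FrameOK R U (nScales β) μ (klFlowFrameU L M β U μ n) := frameOK_klFlowFrameU_of_histP_le hR2 hn1 le_rfl hnN hhist
  have hε0 : 0 ≤ imagTimeWeight β M := imagTimeWeight_nonneg hβ.le M
  have hkJ : k ≤ J' := by omega
  have hc1 : cc ≤ c₃ := hccm.trans ((min_le_left _ _).trans (min_le_left _ _))
  have hc2 : cc ≤ c₃' := hccm.trans ((min_le_left _ _).trans (min_le_right _ _))
  have hc3 : cc ≤ c₃'' := hccm.trans (min_le_right _ _)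
  have hU1 : U ≤ U₀ := hUm.trans ((min_le_left _ _).trans (min_le_left _ _))
  have hU2 : U ≤ U₀' := hUm.trans ((min_le_left _ _).trans (min_le_right _ _))
  have hU3 : U ≤ U₀'' := hUm.trans (min_le_right _ _)
  have hBfib0 : 0 ≤ Bfib := le_trans (le_trans (sq_nonneg _) (le_max_left _ _)) hBfib
  set K : TrigPolyC4v := klFlowFrameU L M β U μ n with hK
  set C' : ℕ := ⌊(Θ + 5 * sectorWidth k) / sectorWidth k⌋₊ with hC'
  set B : Finset (Fin (m + 1) → SectorLeg (sectorCount k)) :=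
    univ.filter fun σ' : Fin (m + 1) → SectorLeg (sectorCount k) =>
      (∃ G₀ : Fin 2 → ℤ, G₀ ≠ 0 ∧ ∀ j : Fin 2,
          |∑ i, (if (σ' i).2 = 0 then klFermiPoint μ K (sectorCenter k (σ' i).1.1) j
            else -klFermiPoint μ K (sectorCenter k (σ' i).1.1) j) - 2 * π * (G₀ j : ℝ)| ≤ ((m : ℝ) + 1) * C * sectorWidth k) ∧
      (∃ b : Fin (sectorCount k), ∀ i, i ≠ q → ∃ Dz : ℤ, |Dz| ≤ (C' : ℕ) ∧ ((2 : ℤ) ^ k) ∣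
        ((((if (σ' i).2 = 0 then ((σ' i).1.1 : ℕ) else
            if ((σ' i).1.1 : ℕ) < 2 ^ k then ((σ' i).1.1 : ℕ) + 2 ^ k else ((σ' i).1.1 : ℕ) - 2 ^ k : ℕ) : ℤ)) - b - Dz)) with hB
  set Mult : ℝ := (2 * ((m : ℝ) + 1) + 1) ^ 2 * (2 * (8 * π * (((m : ℝ) + 1) * C + m * Λ * (C' : ℕ)) / r₀ + 2) * (8 * (2 * ((C' : ℕ) : ℝ) + 1)) ^ m)
    with hMult
  have hMult0 : 0 ≤ Mult := by positivity
  -- the on-class pinned weighted sums: multiplicity × single-tuple sums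
  have hNB : ∀ (ℓ' : SectorLeg (sectorCount k)) (y' : SpaceTimeIdx L M),
      imagTimeWeight β M ^ m * ∑ σ' ∈ B.filter (fun σ' : Fin (m + 1) → SectorLeg (sectorCount k) => σ' q = ℓ'),
        ∑ x' ∈ univ.filter (fun x' : Fin (m + 1) → SpaceTimeIdx L M => x' q = y'),
          klScaleWt L M β j ((univ.image x').image (fun x : SpaceTimeIdx L M => (((((2 * (x.1 : ℕ) : ℕ)) : ZMod (2 * (2 * M)))), x.2))) *
            ‖sectorisedKernel L M β (klAnisoFamily L M β μ K klE0 k) T (m + 1) σ' x'‖ ≤ Mult * Nf := by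
    intro ℓ' y'
    refine (mul_sum_le_card_mul _ _ fun σ' _ => hNf σ' y').trans (mul_le_mul_of_nonneg_right ?_ hNf0)
    have hcnt := hmult cc hcc hc3 U hU hU3 β hβmin hβc μ hμ μ K hfr k m q ℓ' C hC.le C' hsmallv hπC
    refine le_trans (Nat.cast_le.2 (card_le_card fun σ' hσ' => ?_)) hcnt
    simp only [hB, mem_filter, mem_univ, true_and] at hσ' ⊢
    obtain ⟨⟨⟨G₀, _, hG₀⟩, hnar⟩, hpℓ⟩ := hσ'
    exact ⟨hpℓ, ⟨G₀, hG₀⟩, hnar⟩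
  have hA₁ : (0 : ℝ) ≤ (27 : ℝ) * (D₁ ^ (m + 1) + (5 : ℝ) ^ (m + 1) * ((m + 1 : ℕ) ^ 2 * (Bfib * 3 ^ (m - 2)))) * ((2 : ℝ) ^ (J' - k)) ^ (m - 2) := by
    positivity
  have hA₂ : (0 : ℝ) ≤ (D₂ + 1) * ((m : ℝ) + 2) ^ 3 * 27 ^ (m + 1) * ((2 : ℝ) ^ (J' - k)) ^ (m - 1) := by positivity
  have hMN : 0 ≤ Mult * Nf := mul_nonneg hMult0 hNf0
  have h := hsplit m G P Q cc hR2 hcc hcc6 μ hμ U hU hUle hcU β hβmin hβc L M hL3 hM3 n hn1 hnN hkl hhist hosc k J' hJ hJn T hT j hjJ B q w _ _ N (Mult * Nf)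
    hA₁ hA₂ hN0 hMN (fun ℓ'' σ' hσ' => ?_) (fun ℓ'' σ' _ => ?_) hN hNB
  · calc klWtPinnedSumAt L M β μ (klFlowFrameU L M β U μ n) J' j (m + 1) T q w
        ≤ Cm ^ (m + 1) * ((27 : ℝ) * (D₁ ^ (m + 1) + (5 : ℝ) ^ (m + 1) * ((m + 1 : ℕ) ^ 2 * (Bfib * 3 ^ (m - 2)))) * ((2 : ℝ) ^ (J' - k)) ^ (m - 2) * N +
            (D₂ + 1) * ((m : ℝ) + 2) ^ 3 * 27 ^ (m + 1) * ((2 : ℝ) ^ (J' - k)) ^ (m - 1) * (Mult * Nf)) := h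
      _ = _ := by rw [hMult]; ring
  · -- off the class: off the umklapp class, or on it for some `G₀ ≠ 0` and not narrow about `q` ⇒ wide
    have hnot : ¬ ((∃ G₀ : Fin 2 → ℤ, G₀ ≠ 0 ∧ ∀ j : Fin 2,
          |∑ i, (if (σ' i).2 = 0 then klFermiPoint μ K (sectorCenter k (σ' i).1.1) j
            else -klFermiPoint μ K (sectorCenter k (σ' i).1.1) j) - 2 * π * (G₀ j : ℝ)| ≤ ((m : ℝ) + 1) * C * sectorWidth k) ∧
        (∃ b : Fin (sectorCount k), ∀ i, i ≠ q → ∃ Dz : ℤ, |Dz| ≤ (⌊(Θ + 5 * sectorWidth k) / sectorWidth k⌋₊ : ℕ) ∧ ((2 : ℤ) ^ k) ∣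
          ((((if (σ' i).2 = 0 then ((σ' i).1.1 : ℕ) else
              if ((σ' i).1.1 : ℕ) < 2 ^ k then ((σ' i).1.1 : ℕ) + 2 ^ k else ((σ' i).1.1 : ℕ) - 2 ^ k : ℕ) : ℤ)) - b - Dz))) := by
      intro hh
      exact hσ' (by simp only [hB, mem_filter, mem_univ, true_and]; exact hh)
    have hcnt := hoff' cc hcc hc1 U hU hU1 β hβmin hβc μ hμ μ K hfr L M m k J' hk₀ hkJ hm hsmall _ subset_rfl
      ({q} : Finset (Fin (m + 1))) (fun _ => ℓ'') q (mem_singleton_self _) σ' Θ LΨ Bfib hLΨ hΘt hΘδ hΘη hBfib hnot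
    have h1 := offOrWide_count_arith hD₁.le hBfib0 (J' - k) m 0 1 hm (by omega)
    simp only [pow_one, zero_add] at h1
    exact (mul_le_mul_of_nonneg_left hcnt (by norm_num)).trans h1
  · -- on the class: the one-determined-leg count
    have hcnt := hon' m cc hcc hc2 U hU hU2 β hβmin hβc μ hμ μ K hfr L M k J' hkJ _ subset_rfl
      ({q} : Finset (Fin (m + 1))) (fun _ => ℓ'') σ'
    have h1 := legSet_count_arith hD₂' (J' - k) m 1 1 le_rfl (by omega)
    rw [card_singleton] at hcnt
    rw [pow_one] at h1
    exact (mul_le_mul_of_nonneg_left hcnt (by norm_num)).trans h1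

/-- **THE INCREMENT RE-MEASURED WITH THE WEIGHTED NARROW / WIDE SPLIT, NO WINDOW — m-UNIFORM** (twin of `klWtPinnedSumAt_klTowerIncr_narrowWideSplit_le_klEng_flow_all`).
[cite: BenfattoGiulianiMastropietro2006, §2.8 (2.82)-(2.84), (2.88)-(2.90), App. A3] -/
theorem klWtPinnedSumAt_klTowerIncr_narrowWideSplit_le_klEng_flow_all_uniform (R : RenConsts) (c'' : ℝ) (hc'' : 0 ≤ c'') :
    ∃ C₀ : ℝ, 0 < C₀ ∧ ∃ C : ℝ, 0 < C ∧ ∃ D₁ : ℝ, 0 < D₁ ∧ ∃ Cw : ℝ, 0 < Cw ∧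
      ∃ c₂ cb K₁ K₂ c₀ c₂' : ℝ, 0 ≤ c₂ ∧ 0 < cb ∧ 2 + c₂ ≤ K₁ ∧ 0 < K₂ ∧ 0 < c₀ ∧ 0 < c₂' ∧
      ∃ D₂ : ℝ, 0 < D₂ ∧ ∃ k₀ : ℕ,
      (R.WF2 → ∃ c₃ : ℝ, 0 < c₃ ∧ ∃ U₀ : ℝ, 0 < U₀ ∧ ∃ Λ : ℝ, 0 ≤ Λ ∧ ∃ r₀ : ℝ, 0 < r₀ ∧ ∃ v₀ : ℝ, 0 < v₀ ∧
      ∀ m : ℕ, 3 ≤ m →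
      ∀ (G : GeoConsts) (P : SplitConsts) (Q : EngConsts) (cc : ℝ), 0 < cc → cc ≤ klEngC₃6 P R → cc ≤ c₃ →
      ∀ μ ∈ klWindowC, ∀ U : ℝ, 0 < U → U ≤ min (klEngU₀3 P R cc) (1 / (R.Gfr 3 + 1)) → U ≤ U₀ → c'' * U ≤ 1 →
      ∀ β : ℝ, klBetaMin ≤ β → β ≤ Real.exp (cc / U ^ 2) →
      ∀ (L M : ℕ) [NeZero L] [NeZero M], klEngL₃ β U ≤ L → klEngM₃ β U L ≤ M →
      ∀ n : ℕ, 1 ≤ n → n ≤ nScales β + 1 → IsKLRegime U cc (-(n : ℤ)) → HistP klPredsV17F2 L M G P Q R β U μ 0 n →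
        (∀ m', 1 ≤ m' → m' < n → FlowPieceOscAt L M c'' β U μ m') →
        ∀ d k k' : ℕ, 2 ≤ d → k' < k → k₀ ≤ d * k' → d * k - 1 ≤ n →
      ∀ (Θ LΨ Bfib : ℝ), LΨ = (m + 1 : ℕ) + c₂ * (π / 2 + 5 * sectorWidth (d * k')) / (K₁ * Θ) → (2 : ℝ) ^ (-((d * k - 1 : ℕ) : ℤ)) ≤ Θ →
        cb * (2 : ℝ) ^ (-((d * k - 1 : ℕ) : ℤ)) ≤ Θ → K₂ * LΨ * (cb * (2 : ℝ) ^ (-((d * k - 1 : ℕ) : ℤ))) ≤ c₂' * Θ →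
        max ((2 * ((2 * c₀ * K₂ * cb / π + 1) * LΨ)) ^ 2) (4 * cb ^ 2 * K₂ ^ 2 / 1 ^ 2 * LΨ ^ 2) ≤ Bfib →
      ((m : ℝ) + 1) * (Cw + C) * sectorWidth (d * k') < 2 * π →
      (((m : ℝ) + 1) * C + m * Λ * (⌊(Θ + 5 * sectorWidth (d * k')) / sectorWidth (d * k')⌋₊ : ℕ)) * sectorWidth (d * k') < v₀ →
      ((m : ℝ) + 1) * C * sectorWidth (d * k') < π →
        ∀ j : ℕ, d * k - 1 ≤ j → ∀ (q : Fin (m + 1)) (w : SpaceTimeIdx L M × SectorLeg (sectorCount (d * k - 1))),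
          klWtPinnedSumAt L M β μ (klFlowFrameU L M β U μ n) (d * k - 1) j (m + 1) (klTowerIncr L M β U μ (klFlowFrameU L M β U μ n) d k') q w ≤
            C₀ ^ (m + 1) * ((27 : ℝ) * (D₁ ^ (m + 1) + (5 : ℝ) ^ (m + 1) * ((m + 1 : ℕ) ^ 2 * (Bfib * 3 ^ (m - 2)))) * ((2 : ℝ) ^ (d * k - 1 - d * k')) ^ (m - 2) *
                klTowerBornWtAt L M β U μ (klFlowFrameU L M β U μ n) d k' j (m + 1) +
              (D₂ + 1) * ((m : ℝ) + 2) ^ 3 * 27 ^ (m + 1) * ((2 : ℝ) ^ (d * k - 1 - d * k')) ^ (m - 1) *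
                ((2 * ((m : ℝ) + 1) + 1) ^ 2 * (2 * (8 * π * (((m : ℝ) + 1) * C + m * Λ *
                  (⌊(Θ + 5 * sectorWidth (d * k')) / sectorWidth (d * k')⌋₊ : ℕ)) / r₀ + 2) *
                  (8 * (2 * ((⌊(Θ + 5 * sectorWidth (d * k')) / sectorWidth (d * k')⌋₊ : ℕ) : ℝ) + 1)) ^ m)) *
                klTowerBornWtFull L M β U μ (klFlowFrameU L M β U μ n) d k' (m + 1))) := by
  obtain ⟨Cm, hCm, C, hC, D₁, hD₁, Cw, hCw, c₂, cb, K₁, K₂, c₀, c₂', h1, h2, h3, h4, h5, h6, D₂, hD₂, k₀, h⟩ :=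
    klWtPinnedSumAt_jump_le_narrowWideSplit_klEng_flow_all_uniform R c'' hc''
  refine ⟨Cm, hCm, C, hC, D₁, hD₁, Cw, hCw, c₂, cb, K₁, K₂, c₀, c₂', h1, h2, h3, h4, h5, h6, D₂, hD₂, k₀, fun hR2 => ?_⟩
  obtain ⟨c₃, hc₃, U₀, hU₀, Λ, hΛ, r₀, hr₀, v₀, hv₀, h'⟩ := h hR2
  refine ⟨c₃, hc₃, U₀, hU₀, Λ, hΛ, r₀, hr₀, v₀, hv₀, ?_⟩
  intro m hm G P Q cc hcc hcc6 hccm μ hμ U hU hUle hUm hcU β hβmin hβc L M _ _ hL3 hM3 n hn1 hnN hkl hhist hosc d k k' hd hk hk₀ hkn Θ LΨ Bfib hLΨ hΘt hΘδ hΘη hBfib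
    hsmall hsmallv hπC j hj q w
  have hβ : 0 < β := KLRegimeSplit.pos_of_klBetaMin_le hβmin
  have hjk : d * k' ≤ j := by have := block_jump_le hd hk; omega
  exact h' m hm G P Q cc hcc hcc6 hccm μ hμ U hU hUle hUm hcU β hβmin hβc L M hL3 hM3 n hn1 hnN hkl hhist hosc (d * k') (d * k - 1) hk₀ (block_jump_le hd hk) hkn
    Θ LΨ Bfib hLΨ hΘt hΘδ hΘη hBfib hsmall hsmallv hπC (klTowerIncr L M β U μ _ d k') (fun m' X hX => klTowerIncr_momentumConserving β U μ _ d k' m' X hX)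
    j hj q w (klTowerBornWtAt L M β U μ _ d k' j (m + 1)) (klTowerBornWtFull L M β U μ _ d k' (m + 1))
    (klTowerBornWtAt_nonneg hβ.le U μ _ d k' j (m + 1)) (klTowerBornWtFull_nonneg hβ.le U μ _ d k' (m + 1))
    (fun w' => klWtPinnedSumAt_le_klTowerBornWtAt β U μ _ d k' j (m + 1) q w')
    (fun σ' y' => pinnedTupleWtSum_rate_le_klTowerBornWtFull hβ.le U μ _ d k' m hjk q σ' y')

end Summit.HubbardSuperconductivity.HubbardSuperconductivity.Theorems.EngineV8

end
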